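import Literature.AlgebraicGeometry.HodgeTheory.LefschetzDecompositionPolarizationForm
import Literature.AlgebraicGeometry.HodgeTheory.DirectImageTransport
import Literature.AlgebraicGeometry.HodgeTheory.GysinBaseChangeOfKunneth
import Literature.AlgebraicGeometry.Motives.ComplexPointsOrientation
import HarnessLib

/-!
# The polarization form of a global class is monodromy invariant (the polarization of `Rᵏ f_* ℚ` is flat)

Family `hodge`, layer `Literature/AlgebraicGeometry/HodgeTheory` (fact seat of
`bku_finite_monodromyOrbit_of_isHodgeGenericIn`). In the printed proof that Hodge classes at a
Hodge-generic point have finite monodromy orbits (Deligne; Cattani–Deligne–Kaplan 1995 §1;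
Baldi–Klingler–Ullmo §3.2) the polarization `Q` of the variation of Hodge structure `R²ᵖ f_* ℚ` is
FLAT, so all monodromy translates `γ_* α` of a class have the norm `Q(α, α)` — the hypothesis `hQorb`
of the lattice theorem `finite_setOf_isContinuationAlong_of_norm_eq` (`MonodromyOrbitLatticeFiniteness`).
This file PROVES that flatness on the tree's real carriers for the polarization form of the Lefschetz
decomposition (`polarizationForm`, `LefschetzDecompositionPolarizationForm`; Voisin I §6.3.2, §7.1.2:
`Q(x, y) = ∑ (-1)^{a(a-1)/2} τ(L^{n-a} ξ_a x ∪ ξ_a y)` over the primitive parts) of the restriction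
`κ_s = K|_{X_s}` of a GLOBAL class `K ∈ H²(𝒳(ℂ); ℂ)` (the relative hyperplane class):

* `polarizationForm_map_of_commute` — linear algebra on any space: the polarization form of `κ` is
  invariant under every family of additive endomorphisms of `H•(Y; R)` commuting with `L = κ ∪ ·`,
  multiplicative for `∪` and preserving the trace `τ` on `H²ⁿ` (they commute with the primitive
  parts, `map_primitivePart_of_commute`, and with `Lʲ`, `map_lefschetzPowTo_of_commute`);
* `transportFun_lefschetzOperator`, `transportFun_one` — transport along paths (the local system
  `Rᵏ f_* ℂ` on the real carriers, `DirectImageTransport`) commutes with `L` for a global class and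
  fixes `1` (it is multiplicative, `transportFun_cupProduct`, and restrictions of global classes are
  flat, `transportFun_map_fiberι`);
* `transportFun_eq_self_of_top` — **monodromy acts trivially on `H²ⁿ(X_s(ℂ); ℂ)`** of a smooth
  projective fibre of dimension `n` once `κ_s` has the hard Lefschetz property: `H²ⁿ = Lⁿ H⁰` and
  `H⁰(X_s(ℂ); ℂ) = ℂ · 1` (`exists_eq_smul_one`, for the orientation family given by
  `Motives.ComplexPoints.isOrientableOver`);
* `polarizationForm_transportFun`, `polarizationForm_transportFun_self` — **`Q(γ_* x, γ_* y) = Q(x, y)`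
  for every loop `γ` at `s`**, for `Q` the polarization form of `κ_s` with any trace `τ`
  (the vanishing `Hᵐ(X_s(ℂ); ℂ) = 0`, `m > 2n`, being `Motives.ComplexPoints.subsingleton_singularCohomology_of_lt`).

The hard Lefschetz property of `κ_s` is a hypothesis (for the hyperplane class of a projective
embedding it is the tree's theorem `nonempty_hardLefschetzNFold_holds`, `HardLefschetzNFoldHolds`).
With this file and `MonodromyOrbitLatticeFiniteness`, the named fact
`bku_finite_monodromyOrbit_of_isHodgeGenericIn` is reduced to the POSITIVITY of this `Q` on rational
`(p,p)` classes (Hodge–Riemann, Voisin I Thm. 6.32, the object of the tree's programme towards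
`smoothProjective_hodgeStructure_isPolarizable`) and to the Hodge-theoretic statement that the
monodromy translates of a Hodge class at a Hodge-generic point are Hodge classes (Deligne's theorem
of the fixed part / André 1992 §5). Everything here is a theorem; no definition and no named fact
is introduced.

## References

* [VoisinHodgeI2002] C. Voisin, Hodge Theory and Complex Algebraic Geometry I, CUP 2002, §6.2.3
  Cor. 6.26, §6.3.2 Thm. 6.32, §7.1.2, Thm. 6.25, §9.2.1.
* [VoisinHodgeII2003] C. Voisin, Hodge Theory and Complex Algebraic Geometry II, CUP 2003, §3.1.2.
* [CattaniDeligneKaplan1995JAMS] E. Cattani, P. Deligne, A. Kaplan, On the locus of Hodge classes,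
  J. Amer. Math. Soc. 8 (1995), §1.
* [BaldiKlinglerUllmo2024] G. Baldi, B. Klingler, E. Ullmo, Invent. Math. 235 (2024), §3.2.
* [HatcherAT2002] A. Hatcher, Algebraic Topology, CUP 2002, §3.3 Thm. 3.26, Thm. 3.30, p. 235.
-/

noncomputable section

open CategoryTheory AlgebraicGeometry
open _root_.Topology
open Literature.AlgebraicTopology.SingularHomology Literature.Geometry.Kaehler

universe u v

namespace Literature.AlgebraicGeometry.HodgeTheory

section HodgeTheory

/-! ### Endomorphisms commuting with `L`, multiplicative and trace-preserving preserve the polarization form -/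

section Abstract

variable {Y : Type u} [TopologicalSpace Y] {R : Type v} [CommRing R]
  {κ : singularCohomology R R Y 2} {n : ℕ} (hL : HasHardLefschetzProperty κ n)
  (hvan : ∀ m, 2 * n < m → Subsingleton (singularCohomology R R Y m))

/-- **The polarization form is invariant under every family of additive endomorphisms of
`H•(Y; R)` which commutes with the Lefschetz operator `L = κ ∪ ·`, is multiplicative for the cup
product and preserves the trace on `H²ⁿ`.** Such endomorphisms commute with the primitive parts
of the Lefschetz decomposition (`map_primitivePart_of_commute`) and with the iterates `Lʲ`
(`map_lefschetzPowTo_of_commute`), so each Hodge–Riemann pairing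
`(-1)^{a(a-1)/2} τ(L^{n-a} ξ ∪ ξ')` of primitive parts is unchanged. (Applied below to monodromy:
Voisin I §9.2.1 / II §3.1.2, "the intersection form is flat".) [cite: VoisinHodgeI2002, §6.3.2 and §7.1.2] -/
theorem polarizationForm_map_of_commute (τ : singularCohomology R R Y (2 * n) →ₗ[R] R)
    (T : ∀ a, singularCohomology R R Y a →+ singularCohomology R R Y a)
    (hT : ∀ (k l : ℕ) (h : 2 + k = l) (x : singularCohomology R R Y k),
      T l (lefschetzOperator κ h x) = lefschetzOperator κ h (T k x))
    (hcup : ∀ (p q r : ℕ) (h : p + q = r) (x : singularCohomology R R Y p)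
      (y : singularCohomology R R Y q), T r (cupProduct h x y) = cupProduct h (T p x) (T q y))
    (hτ : ∀ z, τ (T (2 * n) z) = τ z) {i : ℕ} (x y : singularCohomology R R Y i) :
    polarizationForm κ n hL hvan τ i (T i x) (T i y) = polarizationForm κ n hL hvan τ i x y := by
  rw [polarizationForm_apply, polarizationForm_apply]
  refine Finset.sum_congr rfl fun p _ ↦ ?_
  rw [← map_primitivePart_of_commute hL hvan T hT p x, ← map_primitivePart_of_commute hL hvan T hT p y]
  generalize primitivePart κ n hL hvan p x = ξ
  generalize primitivePart κ n hL hvan p y = ξ'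
  rcases le_or_gt p.1.1 n with ha | ha
  · obtain ⟨s, hs⟩ : ∃ s, p.1.1 + s = n := ⟨n - p.1.1, by omega⟩
    have hm : p.1.1 + 2 * s = 2 * n - p.1.1 := by omega
    have h : (2 * n - p.1.1) + p.1.1 = 2 * n := by omega
    rw [hodgeRiemannPairing_apply τ hs hm h, hodgeRiemannPairing_apply τ hs hm h,
      ← map_lefschetzPowTo_of_commute T hT, ← hcup, hτ]
  · simp only [hodgeRiemannPairing_of_lt τ ha, LinearMap.zero_apply]

end Abstract

/-! ### Monodromy: transport commutes with `L` for a global class, fixes `1` and the top degree -/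

section Family

variable {𝒳 S : Motives.SchemeOver ℂ} (f : 𝒳 ⟶ S) {U : Set (Motives.ComplexPoints S)}
  (hU : IsCohomologicallyLocallyTrivialOn f U)

/-- **Transport commutes with the Lefschetz operator of a GLOBAL class**: for `K ∈ H²(𝒳(ℂ); ℂ)`
with restrictions `κ_t = K|_{X_t}`, `γ_* (κ_s ∪ x) = κ_t ∪ γ_* x` (transport is multiplicative,
`transportFun_cupProduct`, and restrictions of global classes are flat, `transportFun_map_fiberι`).
[cite: VoisinHodgeII2003, §3.1.2] -/
theorem transportFun_lefschetzOperator (K : complexBetti 𝒳 2) {s t : U} (γ : Path.Homotopic.Quotient s t)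
    {k l : ℕ} (h : 2 + k = l) (x : complexBetti (Motives.fiberOver f s.1) k) :
    transportFun f l hU γ (lefschetzOperator (complexBetti.map (Motives.fiberι f s.1) 2 K) h x) =
      lefschetzOperator (complexBetti.map (Motives.fiberι f t.1) 2 K) h (transportFun f k hU γ x) := by
  rw [lefschetzOperator_apply, lefschetzOperator_apply, transportFun_cupProduct, transportFun_map_fiberι]

/-- **Transport fixes the unit class** `1 ∈ H⁰(X_s(ℂ); ℂ)` (it is the restriction of the global
unit). [cite: VoisinHodgeII2003, §3.1.2] -/
theorem transportFun_one {s t : U} (γ : Path.Homotopic.Quotient s t) :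
    transportFun f 0 hU γ (singularCohomology.one ℂ (Motives.ComplexPoints (Motives.fiberOver f s.1))) =
      singularCohomology.one ℂ (Motives.ComplexPoints (Motives.fiberOver f t.1)) := by
  rw [← singularCohomology.map_one (R := ℂ) (Motives.AlgPoints.mapContinuous (L := ℂ) (Motives.fiberι f s.1)),
    ← singularCohomology.map_one (R := ℂ) (Motives.AlgPoints.mapContinuous (L := ℂ) (Motives.fiberι f t.1))]
  exact transportFun_map_fiberι f 0 hU γ (singularCohomology.one ℂ (Motives.ComplexPoints 𝒳))

/-- **Monodromy acts trivially on the top cohomology `H²ⁿ(X_s(ℂ); ℂ)`** of a smooth projective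
fibre of dimension `n` when the restriction `κ_s` of a global class has the hard Lefschetz property:
`H²ⁿ = Lⁿ H⁰` (hard Lefschetz in degree `0`), `H⁰(X_s(ℂ); ℂ) = ℂ · 1` (`X_s(ℂ)` is a connected
closed manifold, `exists_eq_smul_one`), and transport commutes with `Lⁿ` and fixes `1`.
[cite: VoisinHodgeI2002, Thm. 6.25 and §9.2.1] -/
theorem transportFun_eq_self_of_top (K : complexBetti 𝒳 2) {n : ℕ} {s : U}
    (hXs : Motives.IsSmoothProjective n (Motives.fiberOver f s.1))
    (hL : HasHardLefschetzProperty (complexBetti.map (Motives.fiberι f s.1) 2 K) n)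
    (γ : Path.Homotopic.Quotient s s) (z : complexBetti (Motives.fiberOver f s.1) (2 * n)) :
    transportFun f (2 * n) hU γ z = z := by
  -- `z = Lⁿ w` with `w ∈ H⁰ = ℂ · 1`
  obtain ⟨w, rfl⟩ := (bijective_lefschetzPowTo_of_hasHardLefschetz _ hL (Nat.zero_add n) (2 * n)
    (by omega)).2 z
  let μ : OrientationFamily := fun _ _ h ↦ Classical.choice (Motives.ComplexPoints.isOrientableOver ℂ h)
  obtain ⟨c, rfl⟩ := exists_eq_smul_one μ hXs w
  -- transport along the loop commutes with `Lⁿ` and fixes `c • 1`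
  have hcomm := map_lefschetzPowTo_of_commute
    (fun a ↦ (transportLinear f a hU γ).toAddMonoidHom)
    (fun k l h x ↦ transportFun_lefschetzOperator f hU K γ h x) n 0 (2 * n) (by omega)
    (c • singularCohomology.one ℂ (Motives.ComplexPoints (Motives.fiberOver f s.1)))
  simp only [LinearMap.toAddMonoidHom_coe, transportLinear_apply] at hcomm
  rw [hcomm, transportFun_smul, transportFun_one]

/-- **The polarization form of a global class is monodromy invariant.** For `f : 𝒳 ⟶ S`
cohomologically locally trivial over `U` (so that `R• f_* ℂ` is a local system there), a global
class `K ∈ H²(𝒳(ℂ); ℂ)` whose restriction `κ_s = K|_{X_s}` to the smooth projective fibre `X_s` of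
dimension `n` has the hard Lefschetz property, any "trace" `τ` on `H²ⁿ(X_s(ℂ); ℂ)` and any loop
`γ` at `s`: `Q(γ_* x, γ_* y) = Q(x, y)` for the polarization form
`Q = polarizationForm κ_s n hL hvan τ i` of the Lefschetz decomposition (Voisin I §7.1.2) — transport
commutes with `L` (`transportFun_lefschetzOperator`), is multiplicative (`transportFun_cupProduct`)
and acts trivially on `H²ⁿ` (`transportFun_eq_self_of_top`). This is the flatness of the
polarization used in the proof that Hodge classes at a Hodge-generic point have finite monodromy
orbits (Deligne; Cattani–Deligne–Kaplan §1; Baldi–Klingler–Ullmo §3.2): the monodromy translates of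
a class all have the same `Q`-norm. [cite: VoisinHodgeI2002, §7.1.2 and §9.2.1]
[cite: CattaniDeligneKaplan1995JAMS, §1] -/
theorem polarizationForm_transportFun (K : complexBetti 𝒳 2) {n : ℕ} {s : U}
    (hXs : Motives.IsSmoothProjective n (Motives.fiberOver f s.1))
    (hL : HasHardLefschetzProperty (complexBetti.map (Motives.fiberι f s.1) 2 K) n)
    (hvan : ∀ m, 2 * n < m →
      Subsingleton (singularCohomology ℂ ℂ (Motives.ComplexPoints (Motives.fiberOver f s.1)) m))
    (τ : complexBetti (Motives.fiberOver f s.1) (2 * n) →ₗ[ℂ] ℂ) (γ : Path.Homotopic.Quotient s s)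
    {i : ℕ} (x y : complexBetti (Motives.fiberOver f s.1) i) :
    polarizationForm (complexBetti.map (Motives.fiberι f s.1) 2 K) n hL hvan τ i
        (transportFun f i hU γ x) (transportFun f i hU γ y) =
      polarizationForm (complexBetti.map (Motives.fiberι f s.1) 2 K) n hL hvan τ i x y := by
  have h := polarizationForm_map_of_commute hL hvan τ
    (fun a ↦ (transportLinear f a hU γ).toAddMonoidHom)
    (fun k l h x ↦ transportFun_lefschetzOperator f hU K γ h x)
    (fun p q r h x y ↦ transportFun_cupProduct f hU h γ x y)
    (fun z ↦ congrArg τ (transportFun_eq_self_of_top f hU K hXs hL γ z)) x y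
  simpa only [LinearMap.toAddMonoidHom_coe, transportLinear_apply] using h

/-- The same with the vanishing hypothesis discharged (`Hᵐ(X_s(ℂ); ℂ) = 0` for `m > 2n`,
`Motives.ComplexPoints.subsingleton_singularCohomology_of_lt`) — the `Q`-NORM OF ALL MONODROMY
TRANSLATES of a class is the same: the hypothesis `hQorb` of
`finite_setOf_isContinuationAlong_of_norm_eq` (`MonodromyOrbitLatticeFiniteness`) for this `Q`.
[cite: VoisinHodgeI2002, §7.1.2 and §9.2.1] [cite: CattaniDeligneKaplan1995JAMS, §1] -/
theorem polarizationForm_transportFun_self (K : complexBetti 𝒳 2) {n : ℕ} {s : U}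
    (hXs : Motives.IsSmoothProjective n (Motives.fiberOver f s.1))
    (hL : HasHardLefschetzProperty (complexBetti.map (Motives.fiberι f s.1) 2 K) n)
    (τ : complexBetti (Motives.fiberOver f s.1) (2 * n) →ₗ[ℂ] ℂ) (γ : Path.Homotopic.Quotient s s)
    {i : ℕ} (x : complexBetti (Motives.fiberOver f s.1) i) :
    polarizationForm (complexBetti.map (Motives.fiberι f s.1) 2 K) n hL
        (fun _ hm ↦ Motives.ComplexPoints.subsingleton_singularCohomology_of_lt hXs ℂ hm) τ i
        (transportFun f i hU γ x) (transportFun f i hU γ x) =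
      polarizationForm (complexBetti.map (Motives.fiberι f s.1) 2 K) n hL
        (fun _ hm ↦ Motives.ComplexPoints.subsingleton_singularCohomology_of_lt hXs ℂ hm) τ i x x :=
  polarizationForm_transportFun f hU K hXs hL _ τ γ x x

end Family

end HodgeTheory

end Literature.AlgebraicGeometry.HodgeTheory

end
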